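import Mathlib.NumberTheory.NumberField.Discriminant.Defs
import Mathlib.RingTheory.DedekindDomain.AdicValuation
import Mathlib.RingTheory.DedekindDomain.IntegralClosure
import Mathlib.RingTheory.Discriminant
import Mathlib.Algebra.Polynomial.Inductions
import Mathlib.RingTheory.Polynomial.GaussLemma
import Mathlib.NumberTheory.NumberField.Basic
import HarnessLib

/-!
# The tail order of a (non-monic) integer polynomial and the field discriminant of `ℚ[X]/(g)`

Topic `Literature/NumberTheory/LFunctions`, grouping namespace `DegreeOnePrimes` (next to
`DegreeOnePrimes.lean`: Dedekind–Kummer counts of the degree-one primes of `ℚ[X]/(g)` for MONIC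
`g`). First of three algebraic bricks (`DegreeOnePrimesTailOrder`, `…DiscriminantBound`,
`…ScaledRoot`) of the reduction of Bürgisser's Cor. 4.8 (*Cook's versus Valiant's hypothesis*,
TCS 235 (2000), §4.2: the primes modulo which an irreducible `g ∈ ℤ[Y]` has a root, under GRH;
`Literature/Computability/AlgebraicComplexity/BurgisserReductionModPrimes.lean`,
`rootModPrimeCount_lower_bound_of_GRH`) to the effective prime ideal theorem under GRH
(`EffectivePrimeIdealTheoremGRH.lean`). Bürgisser's `g` is irreducible but NOT monic, and the
error term of Cor. 4.8 only allows `log |d_K| = O(d log(dw))` for `K = ℚ[Y]/(g)` of degree `d` and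
weight `w`; the power basis of the algebraic integer `g_d y` has discriminant
`g_d^{(d-1)(d-2)} disc g`, too large by a factor `e^{O(d² log w)}`. The classical remedy is the
*invariant order* of the binary form `g(X, Z)` (Birch–Merriman 1972; Nakagawa 1989; Simon 2001),
spanned by `1` and the "tails" `ω_k = g_d y^k + g_{d-1} y^{k-1} + ⋯ + g_{d-k+1} y`, whose
discriminant is exactly `disc g`. This file proves what is needed of it, for `g ∈ ℤ[X]`
irreducible over `ℚ` and `K_g = ℚ[X]/(g)` with root `y`. Everything here is PROVED (no named
facts).

* `coeff_divX_iterate`, `X_pow_mul_divX_iterate_add` — the tails `divX^[m] g = ∑ᵢ g_{i+m} Xⁱ` and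
  `g = X^m · divX^[m] g + ∑_{i<m} gᵢ Xⁱ`.
* `valuation_aeval_divX_iterate_le_one`, `aeval_divX_iterate_mem_range` — **the tails at a root
  are algebraic integers**: `(divX^[m] g)(y) ∈ 𝓞 K` whenever `g(y) = 0` (place by place:
  trivial where `v(y) ≤ 1`, and `y^m · tail = −(lower part)` where `v(y) > 1`; then Mathlib's
  `HeightOneSpectrum.mem_integers_of_valuation_le_one`).
* `RootField g = AdjoinRoot (g ⊗ ℚ)`, `powFamily g = (y^j)_{j<d}`, `tailFamily g = (b_k)_{k<d}`,
  `b_k = (divX^[d-k] g)(y) = ∑_{j ≤ k} g_{d-k+j} y^j` (so `b_0 = g_d`, `b_k = ω_k + g_{d-k}`),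
  `tailMatrix g` (lower triangular, diagonal `g_d`): `disc(b) = g_d^{2d} disc(1, y, …, y^{d-1})`
  (`discr_tailFamily`), nonzero.
* `exists_discr_tailFamily_eq_and_discr_dvd`, `tailDiscr g = D_g ∈ ℤ`, `cast_tailDiscr`,
  `discr_dvd_tailDiscr`, `tailDiscr_ne_zero` — **`d_{K_g}` divides the integer `D_g = disc(b)`**
  (the `b_k` are an integral matrix times an integral basis). (`D_g = g_d² disc g`; this identity
  is neither needed nor proved.)

## References

* J. Nakagawa, *Binary forms and orders of algebraic number fields*, Invent. Math. 97 (1989),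
  219–235, §1 (the order of a binary form and its discriminant); D. Simon, *The index of nonmonic
  polynomials*, Indag. Math. (N.S.) 12 (2001), 505–517, §2. Only the integrality of the tails and
  `d_K ∣ disc` are used here, with self-contained proofs, tagged folklore.
* P. Bürgisser, *Cook's versus Valiant's hypothesis*, TCS 235 (2000), §4.2 pp. 83–84
  (`Burgisser2000TCS`).
-/

noncomputable section

open Polynomial NumberField

namespace Literature.NumberTheory.LFunctions

namespace DegreeOnePrimes

/-! ### Tails of a polynomial: `divX^[m] p = ∑ᵢ p_{i+m} Xⁱ` -/

/-- The coefficients of the `m`-th tail `divX^[m] p` are the shifted coefficients of `p`.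
[folklore] -/
theorem coeff_divX_iterate {R : Type*} [Semiring R] (p : R[X]) (m i : ℕ) :
    (divX^[m] p).coeff i = p.coeff (i + m) := by
  induction m generalizing i with
  | zero => simp
  | succ m ih =>
    rw [Function.iterate_succ_apply', coeff_divX, ih, Nat.add_right_comm, Nat.add_assoc]

/-- The `m`-th tail of `p` has degree at most `deg p - m`. [folklore] -/
theorem natDegree_divX_iterate_le {R : Type*} [Semiring R] (p : R[X]) (m : ℕ) :
    (divX^[m] p).natDegree ≤ p.natDegree - m := by
  induction m with
  | zero => simp
  | succ m ih =>
    rw [Function.iterate_succ_apply', natDegree_divX_eq_natDegree_tsub_one]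
    omega

/-- Division with remainder by `X^m`: `p = X^m · divX^[m] p + ∑_{i<m} pᵢ Xⁱ`. [folklore] -/
theorem X_pow_mul_divX_iterate_add {R : Type*} [CommSemiring R] (p : R[X]) (m : ℕ) :
    X ^ m * (divX^[m] p) + ∑ i ∈ Finset.range m, C (p.coeff i) * X ^ i = p := by
  induction m with
  | zero => simp
  | succ m ih =>
    conv_rhs => rw [← ih, ← divX_mul_X_add (divX^[m] p)]
    rw [Finset.sum_range_succ, Function.iterate_succ_apply', coeff_divX_iterate, zero_add]
    ring

/-! ### Integrality of the tails evaluated at a root -/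

section Integrality

variable {K : Type*} [Field K] [NumberField K]

/-- An integer polynomial evaluated at `y` has valuation `≤ 1` at every finite place where `y`
does. [folklore] -/
theorem valuation_aeval_le_one_of_le_one (q : ℤ[X]) {y : K}
    (v : IsDedekindDomain.HeightOneSpectrum (𝓞 K)) (hy : v.valuation K y ≤ 1) :
    v.valuation K (aeval y q) ≤ 1 := by
  rw [aeval_eq_sum_range]
  refine Valuation.map_sum_le _ fun i _ => ?_
  rw [Algebra.smul_def, map_mul, map_pow, algebraMap_int_eq, eq_intCast]
  have h1 : v.valuation K ((q.coeff i : ℤ) : K) ≤ 1 := by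
    simpa using v.valuation_le_one (K := K) ((q.coeff i : ℤ) : 𝓞 K)
  calc v.valuation K ((q.coeff i : ℤ) : K) * v.valuation K y ^ i ≤ 1 * 1 ^ i := by
        gcongr
    _ = 1 := by simp

/-- **The tails of `g` at a root are algebraic integers, valuation form.** If `g(y) = 0` for an
integer polynomial `g`, then for every `m` and every finite place `v` of `K`,
`v(∑ᵢ g_{i+m} yⁱ) ≤ 1`: when `v(y) ≤ 1` trivially, and when `v(y) > 1` because
`yᵐ · ∑ᵢ g_{i+m} yⁱ = −∑_{i<m} gᵢ yⁱ` has valuation `< v(y)ᵐ` (the classical proof that the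
"invariant order" of a binary form consists of integers). [folklore] -/
theorem valuation_aeval_divX_iterate_le_one (g : ℤ[X]) {y : K} (hy : aeval y g = 0) (m : ℕ)
    (v : IsDedekindDomain.HeightOneSpectrum (𝓞 K)) :
    v.valuation K (aeval y (divX^[m] g)) ≤ 1 := by
  by_cases hvy : v.valuation K y ≤ 1
  · exact valuation_aeval_le_one_of_le_one _ v hvy
  push Not at hvy
  have hvy0 : v.valuation K y ≠ 0 := ne_zero_of_lt hvy
  -- `y^m T(y) + R(y) = g(y) = 0`
  have key := congrArg (aeval y) (X_pow_mul_divX_iterate_add g m)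
  rw [hy, map_add, map_mul, map_pow, aeval_X, map_sum] at key
  simp only [map_mul, map_pow, aeval_X, eq_intCast, map_intCast] at key
  -- the remainder has valuation `< v(y)^m`
  have hR : v.valuation K (∑ i ∈ Finset.range m, ((g.coeff i : ℤ) : K) * y ^ i) <
      v.valuation K y ^ m := by
    refine Valuation.map_sum_lt _ (pow_ne_zero _ hvy0) fun i hi => ?_
    rw [Finset.mem_range] at hi
    rw [map_mul, map_pow]
    have h1 : v.valuation K ((g.coeff i : ℤ) : K) ≤ 1 := by
      simpa using v.valuation_le_one (K := K) ((g.coeff i : ℤ) : 𝓞 K)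
    calc v.valuation K ((g.coeff i : ℤ) : K) * v.valuation K y ^ i ≤ 1 * v.valuation K y ^ i := by
          gcongr
      _ = v.valuation K y ^ i := one_mul _
      _ < v.valuation K y ^ m := pow_lt_pow_right₀ hvy hi
  have hT : y ^ m * aeval y (divX^[m] g) = -∑ i ∈ Finset.range m, ((g.coeff i : ℤ) : K) * y ^ i :=
    eq_neg_of_add_eq_zero_left key
  have h2 : v.valuation K (aeval y (divX^[m] g)) * v.valuation K y ^ m <
      1 * v.valuation K y ^ m := by
    rw [mul_comm, ← map_pow, ← map_mul, hT, Valuation.map_neg, one_mul, map_pow]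
    exact hR
  exact (lt_of_mul_lt_mul_right' h2).le

/-- **The tails of `g` at a root are algebraic integers** (the ℤ-module they span is the
"invariant order" of the binary form `g(X, Z)`; Birch–Merriman, Nakagawa, Simon): if `g ∈ ℤ[X]`
and `g(y) = 0` in a number field `K`, then `∑ᵢ g_{i+m} yⁱ ∈ 𝓞 K` for every `m`
(an element of valuation `≤ 1` at all finite places is integral). [folklore] -/
theorem aeval_divX_iterate_mem_range (g : ℤ[X]) {y : K} (hy : aeval y g = 0) (m : ℕ) :
    aeval y (divX^[m] g) ∈ (algebraMap (𝓞 K) K).range :=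
  IsDedekindDomain.HeightOneSpectrum.mem_integers_of_valuation_le_one K _
    (valuation_aeval_divX_iterate_le_one g hy m)

end Integrality


/-! ### The number field `K_g = ℚ[X]/(g)` and its two families -/

section RootField

variable (g : ℤ[X]) [Fact (Irreducible (g.map (algebraMap ℤ ℚ)))]

/-- The number field `K_g = ℚ[X]/(g)` cut out by an integer polynomial `g` irreducible over `ℚ`
(Bürgisser 2000 TCS, §4.2: "the number field `K = ℚ[Y]/(g)`"). [folklore] -/
abbrev RootField : Type := AdjoinRoot (g.map (algebraMap ℤ ℚ))

/-- `g ≠ 0` over `ℚ`. [folklore] -/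
theorem map_rat_ne_zero : g.map (algebraMap ℤ ℚ) ≠ 0 :=
  (Fact.out : Irreducible (g.map (algebraMap ℤ ℚ))).ne_zero

omit [Fact (Irreducible (g.map (algebraMap ℤ ℚ)))] in
/-- `deg_ℚ g = deg g`. [folklore] -/
theorem natDegree_map_rat : (g.map (algebraMap ℤ ℚ)).natDegree = g.natDegree :=
  natDegree_map_eq_of_injective (algebraMap ℤ ℚ).injective_int g

/-- `deg g ≥ 1` for `g` irreducible over `ℚ`. [folklore] -/
theorem rootField_natDegree_pos : 0 < g.natDegree := by
  rw [← natDegree_map_rat g]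
  exact natDegree_pos_iff_degree_pos.mpr (degree_pos_of_irreducible (Fact.out))

/-- `g ≠ 0`. [folklore] -/
theorem ne_zero_of_fact_irreducible : g ≠ 0 := by
  rintro rfl
  exact map_rat_ne_zero 0 (Polynomial.map_zero _)

/-- The class `y` of `X` in `K_g` is a root of `g`. [folklore] -/
theorem aeval_root_eq_zero : aeval (AdjoinRoot.root (g.map (algebraMap ℤ ℚ))) g = 0 := by
  rw [aeval_def, Subsingleton.elim (algebraMap ℤ (RootField g))
    ((AdjoinRoot.of (g.map (algebraMap ℤ ℚ))).comp (algebraMap ℤ ℚ)), ← eval₂_map]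
  exact AdjoinRoot.eval₂_root _

/-- `[K_g : ℚ] = deg g`. [folklore] -/
theorem finrank_rootField : Module.finrank ℚ (RootField g) = g.natDegree := by
  rw [PowerBasis.finrank (AdjoinRoot.powerBasis (map_rat_ne_zero g)), AdjoinRoot.powerBasis_dim,
    natDegree_map_rat]

/-- The power family `(1, y, …, y^{d-1})` of `K_g`, `d = deg g` (the power basis of
`AdjoinRoot`, reindexed by `Fin (deg g)`). [folklore] -/
def powFamily : Fin g.natDegree → RootField g :=
  fun j => AdjoinRoot.root (g.map (algebraMap ℤ ℚ)) ^ (j : ℕ)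

/-- The power family is the power basis of `K_g = ℚ[X]/(g)` reindexed along `deg_ℚ g = deg g`.
[folklore] -/
theorem powFamily_eq_basis_comp :
    powFamily g = ⇑(AdjoinRoot.powerBasis (map_rat_ne_zero g)).basis ∘
      ⇑(finCongr ((AdjoinRoot.powerBasis_dim (map_rat_ne_zero g)).trans
        (natDegree_map_rat g))).symm := by
  funext j
  simp [powFamily, AdjoinRoot.powerBasis_gen]

/-- The power family has nonzero discriminant (it is a basis of the separable extension
`K_g/ℚ`). [folklore] -/
theorem discr_powFamily_ne_zero : Algebra.discr ℚ (powFamily g) ≠ 0 := by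
  rw [powFamily_eq_basis_comp, Algebra.discr_reindex]
  exact Algebra.discr_not_zero_of_basis ℚ _

/-- The **tail family** `b_k = ∑_{j ≤ k} g_{d-k+j} y^j = (divX^{[d-k]} g)(y)` (`0 ≤ k < d`) of
`K_g`: `b_0 = g_d`, `b_1 = g_d y + g_{d-1}`, …; together with `1` it spans the invariant order of the
binary form `g(X, Z)` (Nakagawa 1989; Simon 2001), of discriminant `disc g`. [folklore] -/
def tailFamily : Fin g.natDegree → RootField g :=
  fun k => aeval (AdjoinRoot.root (g.map (algebraMap ℤ ℚ))) (divX^[g.natDegree - k] g)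

/-- The (lower triangular) transition matrix from the power family to the tail family:
`P_{kj} = g_{j + d - k}`. [folklore] -/
def tailMatrix : Matrix (Fin g.natDegree) (Fin g.natDegree) ℚ :=
  Matrix.of fun k j => (g.coeff (j + (g.natDegree - k)) : ℚ)

/-- `b = P · (y^j)_j`. [folklore] -/
theorem tailFamily_eq_mulVec :
    tailFamily g = ((tailMatrix g).map (algebraMap ℚ (RootField g))).mulVec (powFamily g) := by
  funext k
  have hlt : (divX^[g.natDegree - k] g).natDegree < g.natDegree :=
    lt_of_le_of_lt (natDegree_divX_iterate_le g _) (by have := k.2; omega)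
  rw [tailFamily, aeval_eq_sum_range' hlt, Matrix.mulVec, dotProduct, Finset.sum_range]
  refine Finset.sum_congr rfl fun j _ => ?_
  simp [tailMatrix, powFamily, coeff_divX_iterate, Algebra.smul_def]

omit [Fact (Irreducible (g.map (algebraMap ℤ ℚ)))] in
/-- `det P = g_d ^ d`. [folklore] -/
theorem det_tailMatrix : (tailMatrix g).det = (g.leadingCoeff : ℚ) ^ g.natDegree := by
  rw [Matrix.det_of_lowerTriangular (tailMatrix g)]
  · have h : ∀ k : Fin g.natDegree, tailMatrix g k k = (g.leadingCoeff : ℚ) := by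
      intro k
      have hk := k.2
      simp only [tailMatrix, Matrix.of_apply, leadingCoeff]
      congr 2
      omega
    simp only [h, Finset.prod_const, Finset.card_univ, Fintype.card_fin]
  · intro i j hij
    simp only [OrderDual.toDual_lt_toDual] at hij
    simp only [tailMatrix, Matrix.of_apply, Int.cast_eq_zero]
    apply coeff_eq_zero_of_natDegree_lt
    have := i.2; have := j.2
    have h : (i : ℕ) < j := hij
    omega

/-- `disc(b) = g_d^{2d} · disc(1, y, …, y^{d-1})`. [folklore] -/
theorem discr_tailFamily :
    Algebra.discr ℚ (tailFamily g) =
      ((g.leadingCoeff : ℚ) ^ g.natDegree) ^ 2 * Algebra.discr ℚ (powFamily g) := by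
  rw [tailFamily_eq_mulVec, Algebra.discr_of_matrix_mulVec, det_tailMatrix]

/-- `disc(b) ≠ 0`. [folklore] -/
theorem discr_tailFamily_ne_zero : Algebra.discr ℚ (tailFamily g) ≠ 0 := by
  rw [discr_tailFamily]
  refine mul_ne_zero (pow_ne_zero _ (pow_ne_zero _ ?_)) (discr_powFamily_ne_zero g)
  have h : g.leadingCoeff ≠ 0 := by
    rw [Ne, leadingCoeff_eq_zero]
    rintro rfl
    exact map_rat_ne_zero 0 (Polynomial.map_zero _)
  exact_mod_cast h


/-- Every member of the tail family is an algebraic integer of `K_g`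
(`aeval_divX_iterate_mem_range`). [folklore] -/
theorem tailFamily_mem_range (k : Fin g.natDegree) :
    tailFamily g k ∈ (algebraMap (𝓞 (RootField g)) (RootField g)).range :=
  aeval_divX_iterate_mem_range g (aeval_root_eq_zero g) _

/-- **The field discriminant divides the discriminant of the tail family**: there is an integer
`D` with `D = disc_ℚ(b_0, …, b_{d-1})` and `d_{K_g} ∣ D` — the tail family consists of algebraic
integers, so it is an integral matrix `M` times an integral basis and `disc(b) = (det M)² d_K`
(Nakagawa 1989 / Simon 2001: the invariant order of `g` has discriminant `disc g`, whence
`d_K ∣ disc g`; here in the weaker form sufficient for size bounds). [folklore] -/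
theorem exists_discr_tailFamily_eq_and_discr_dvd :
    ∃ D : ℤ, (D : ℚ) = Algebra.discr ℚ (tailFamily g) ∧ NumberField.discr (RootField g) ∣ D := by
  classical
  set K := RootField g
  -- integral representatives and their coordinates in an integral basis
  have hx : ∀ k, ∃ x : 𝓞 K, algebraMap (𝓞 K) K x = tailFamily g k := fun k =>
    tailFamily_mem_range g k
  choose x hx using hx
  -- reindex the integral basis by `Fin d`
  have hcard : Fintype.card (Module.Free.ChooseBasisIndex ℤ (𝓞 K)) = g.natDegree := by
    rw [← Module.finrank_eq_card_chooseBasisIndex, RingOfIntegers.rank, finrank_rootField]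
  set e : Module.Free.ChooseBasisIndex ℤ (𝓞 K) ≃ Fin g.natDegree := Fintype.equivFinOfCardEq hcard
  set M : Matrix (Fin g.natDegree) (Fin g.natDegree) ℤ :=
    Matrix.of fun k j => (RingOfIntegers.basis K).repr (x k) (e.symm j)
  refine ⟨M.det ^ 2 * NumberField.discr K, ?_, dvd_mul_left _ _⟩
  -- `b = M · (integral basis)`
  have hb : tailFamily g =
      ((M.map (algebraMap ℤ ℚ)).map (algebraMap ℚ K)).mulVec (⇑(integralBasis K) ∘ ⇑e.symm) := by
    funext k
    rw [Matrix.mulVec, dotProduct, ← hx k]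
    conv_lhs => rw [← (integralBasis K).sum_repr (algebraMap (𝓞 K) K (x k))]
    rw [← Equiv.sum_comp e.symm]
    refine Finset.sum_congr rfl fun j _ => ?_
    rw [integralBasis_repr_apply, Algebra.smul_def]
    simp [M]
  rw [hb, Algebra.discr_of_matrix_mulVec, Algebra.discr_reindex, ← coe_discr,
    show M.map ⇑(algebraMap ℤ ℚ) = (algebraMap ℤ ℚ).mapMatrix M from rfl, ← RingHom.map_det]
  simp only [eq_intCast, Int.cast_mul, Int.cast_pow, K]

/-- The **tail discriminant** of `g`: the integer `D_g = disc_ℚ(b_0, …, b_{d-1})` (it equals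
`g_d² · disc(g)`, the discriminant of the lattice `ℤ b_0 ⊕ ⋯ ⊕ ℤ b_{d-1} ∋ g_d` of the invariant
order; we only use that it is a nonzero integer multiple of `d_{K_g}` of controlled size).
[folklore] -/
def tailDiscr : ℤ := (Algebra.discr ℚ (tailFamily g)).num

/-- `D_g = disc(b)` in `ℚ`. [folklore] -/
theorem cast_tailDiscr : (tailDiscr g : ℚ) = Algebra.discr ℚ (tailFamily g) := by
  obtain ⟨D, hD, -⟩ := exists_discr_tailFamily_eq_and_discr_dvd g
  rw [tailDiscr, ← hD, Rat.num_intCast]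

/-- `d_{K_g} ∣ D_g`. [folklore] -/
theorem discr_dvd_tailDiscr : NumberField.discr (RootField g) ∣ tailDiscr g := by
  obtain ⟨D, hD, hdvd⟩ := exists_discr_tailFamily_eq_and_discr_dvd g
  have : tailDiscr g = D := by exact_mod_cast (cast_tailDiscr g).trans hD.symm
  rwa [this]

/-- `D_g ≠ 0`. [folklore] -/
theorem tailDiscr_ne_zero : tailDiscr g ≠ 0 := by
  intro h
  apply discr_tailFamily_ne_zero g
  rw [← cast_tailDiscr, h, Int.cast_zero]

end RootField


end DegreeOnePrimes

end Literature.NumberTheory.LFunctions
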